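import Summits.FinalStateConjecture.FinalStateConjecture.Theorems.SwallowTheDatumKerrShieldedSettlesStubKerrVacuumAux8
import Summits.FinalStateConjecture.FinalStateConjecture.Theorems.SwallowTheDatumKerrShieldedSettlesStubKerrVacuumAux9
import Summits.FinalStateConjecture.FinalStateConjecture.Theorems.SwallowTheDatumKerrShieldedSettlesStubKerrVacuumAux10
import Summits.FinalStateConjecture.FinalStateConjecture.Theorems.SwallowTheDatumKerrShieldedSettlesStubKerrVacuumAux11
import Summits.FinalStateConjecture.FinalStateConjecture.Theorems.SwallowTheDatumKerrShieldedSettlesStubKerrVacuumAux12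
import Summits.FinalStateConjecture.FinalStateConjecture.Theorems.SwallowTheDatumKerrShieldedSettlesStubKerrVacuumAux13
import HarnessLib

/-!
# Kerr is Ricci-flat, algebra XIII: `R_{kl} = 0` algebraically

Support file for the stub `stub_kerrVacuum` of line `tapered-temporal-collar` (crux
`stmt-FinalStateConjecture-10054`): the Kerr metric `g_{M,a} = η + 2H ℓ ⊗ ℓ` in ingoing
Kerr–Schild Cartesian coordinates is Ricci-flat for all real `M, a, r₀` (`Kerr.isRicciFlat`).
The pure algebra is done over six real variables `(a, M, x₁, x₂, r, c)`: at a point of the chart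
with Kerr–Schild radius `r > 0` put `c = z/r` (`= cos θ`), so that the defining quartic of `r`
reads `x₂² = (r² + a²)(1 − c²) − x₁²`, and `Σ = r² + a²c²`, `H = M r/Σ`,
`ℓ = (1, (r x₁ + a x₂)/(r² + a²), (r x₂ − a x₁)/(r² + a²), c)`.
The closed forms of `Φ_{kl}`, `Ξ_{kl}` for all indices and the sixteen identities
`½(Φ_{kl} + Φ_{lk} − Ξ_{kl}) − ∑_m Γ^m_{kl} Ψ_m − T_{kl} = 0`, the coordinate form of `Ric(g_{M,a}) = 0` in
the unimodular Kerr–Schild coordinates, modulo the quartic of `r`. Kerr, PRL 11 (1963); Kerr–Schild 1965,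
§3; O'Neill 1995, Thm. 2.6.1.

## References

* R. P. Kerr, *Gravitational field of a spinning mass as an example of algebraically special
  metrics*, Phys. Rev. Lett. 11 (1963) 237–238.
* R. P. Kerr, A. Schild, *A new class of vacuum solutions of the Einstein field equations*
  (1965), §§2–3.
* M. Visser, *The Kerr spacetime: a brief introduction*, arXiv:0706.0622, (32)–(36).
* B. O'Neill, *The geometry of Kerr black holes* (1995), Ch. 2, Thm. 2.6.1.
-/

set_option linter.dupNamespace false
set_option linter.unusedSimpArgs false
set_option linter.unusedTactic false
set_option linter.unreachableTactic false
set_option linter.unnecessarySeqFocus false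

noncomputable section

namespace Summit.FinalStateConjecture.FinalStateConjecture.Theorems.SwallowTheDatum.KerrShieldedSettles

namespace StubKerrVacuum

/-- `Φ_{kl} = ∑_{iβ} g^{iβ} ∂_i∂_k g_{lβ}` in closed form. [cite: KerrSchild1965, §3] -/
theorem phiT_eq (a M x₁ x₂ r c : ℝ) (_hr : r ≠ 0) (_hS : r^2 + a^2*c^2 ≠ 0) (_hP : r^2 + a^2 ≠ 0)
    (_hC : x₂^2 = (r^2 + a^2)*(1 - c^2) - x₁^2) (k l : Fin 4) :
    ∑ i : Fin 4, ∑ β : Fin 4,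
        ginvT a M x₁ x₂ r c i β * d2gT a M x₁ x₂ r c i k l β = phiT a M x₁ x₂ r c k l := by
  fin_cases k <;> fin_cases l
  exacts [phiT_eq_00 a M x₁ x₂ r c _hr _hS _hP _hC, phiT_eq_01 a M x₁ x₂ r c _hr _hS _hP _hC,
      phiT_eq_02 a M x₁ x₂ r c _hr _hS _hP _hC, phiT_eq_03 a M x₁ x₂ r c _hr _hS _hP _hC,
      phiT_eq_10 a M x₁ x₂ r c _hr _hS _hP _hC, phiT_eq_11 a M x₁ x₂ r c _hr _hS _hP _hC,
      phiT_eq_12 a M x₁ x₂ r c _hr _hS _hP _hC, phiT_eq_13 a M x₁ x₂ r c _hr _hS _hP _hC,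
      phiT_eq_20 a M x₁ x₂ r c _hr _hS _hP _hC, phiT_eq_21 a M x₁ x₂ r c _hr _hS _hP _hC,
      phiT_eq_22 a M x₁ x₂ r c _hr _hS _hP _hC, phiT_eq_23 a M x₁ x₂ r c _hr _hS _hP _hC,
      phiT_eq_30 a M x₁ x₂ r c _hr _hS _hP _hC, phiT_eq_31 a M x₁ x₂ r c _hr _hS _hP _hC,
      phiT_eq_32 a M x₁ x₂ r c _hr _hS _hP _hC, phiT_eq_33 a M x₁ x₂ r c _hr _hS _hP _hC]

/-- `Ξ_{kl} = ∑_{iβ} g^{iβ} ∂_i∂_β g_{kl}` in closed form. [cite: KerrSchild1965, §3] -/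
theorem xiT_eq (a M x₁ x₂ r c : ℝ) (_hr : r ≠ 0) (_hS : r^2 + a^2*c^2 ≠ 0) (_hP : r^2 + a^2 ≠ 0)
    (_hC : x₂^2 = (r^2 + a^2)*(1 - c^2) - x₁^2) (k l : Fin 4) :
    ∑ i : Fin 4, ∑ β : Fin 4,
        ginvT a M x₁ x₂ r c i β * d2gT a M x₁ x₂ r c i β k l = xiT a M x₁ x₂ r c k l := by
  fin_cases k <;> fin_cases l
  exacts [xiT_eq_00 a M x₁ x₂ r c _hr _hS _hP _hC, xiT_eq_01 a M x₁ x₂ r c _hr _hS _hP _hC,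
      xiT_eq_02 a M x₁ x₂ r c _hr _hS _hP _hC, xiT_eq_03 a M x₁ x₂ r c _hr _hS _hP _hC,
      xiT_eq_10 a M x₁ x₂ r c _hr _hS _hP _hC, xiT_eq_11 a M x₁ x₂ r c _hr _hS _hP _hC,
      xiT_eq_12 a M x₁ x₂ r c _hr _hS _hP _hC, xiT_eq_13 a M x₁ x₂ r c _hr _hS _hP _hC,
      xiT_eq_20 a M x₁ x₂ r c _hr _hS _hP _hC, xiT_eq_21 a M x₁ x₂ r c _hr _hS _hP _hC,
      xiT_eq_22 a M x₁ x₂ r c _hr _hS _hP _hC, xiT_eq_23 a M x₁ x₂ r c _hr _hS _hP _hC,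
      xiT_eq_30 a M x₁ x₂ r c _hr _hS _hP _hC, xiT_eq_31 a M x₁ x₂ r c _hr _hS _hP _hC,
      xiT_eq_32 a M x₁ x₂ r c _hr _hS _hP _hC, xiT_eq_33 a M x₁ x₂ r c _hr _hS _hP _hC]

set_option maxRecDepth 8192 in
set_option maxHeartbeats 8000000 in
/-- **The Ricci tensor of the Kerr metric vanishes, algebraic core**: in Kerr–Schild
coordinates `R_{kl} = ½(Φ_{kl} + Φ_{lk} − Ξ_{kl}) − ∑_m Γ^m_{kl} Ψ_m − T_{kl} = 0` for all
`k, l` — sixteen rational identities modulo the quartic of `r`. Kerr 1963; Kerr–Schild 1965, §3.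
[cite: KerrSchild1965, §3] -/
theorem ricci_alg (a M x₁ x₂ r c : ℝ) (_hr : r ≠ 0) (_hS : r^2 + a^2*c^2 ≠ 0) (_hP : r^2 + a^2 ≠ 0)
    (_hC : x₂^2 = (r^2 + a^2)*(1 - c^2) - x₁^2) (k l : Fin 4) :
    2⁻¹ * (phiT a M x₁ x₂ r c k l + phiT a M x₁ x₂ r c l k - xiT a M x₁ x₂ r c k l)
      - ∑ m : Fin 4,
          gamT a M x₁ x₂ r c m k l * psiT a M x₁ x₂ r c m - t4T a M x₁ x₂ r c k l = 0 := by
  fin_cases k <;> fin_cases l <;>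
    simp only [phiT, xiT, t4T] <;>
    simp only [Fin.sum_univ_four, hT, ellT, kupT, etaT, sgnT, gT, ginvT, drT, dhT, dl1T,
      dl2T, dl3T, dlT, d2rT, d2hT, d2l1T, d2l2T, d2l3T, d2lT, dgT, kzT, d2gT, kT, kT00, kT01, kT02,
          kT03,
      kT11, kT12, kT13, kT22, kT23, kT33, fDfT, dfT, gamT, psiT, Fin.isValue, Fin.reduceEq, if_true,
      if_false] <;>
    (field_simp <;> ring_nf <;> (try simp only [xp16 _hC, xp15 _hC, xp14 _hC, xp13 _hC, xp12 _hC,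
        xp11 _hC,
      xp10 _hC, xp9 _hC, xp8 _hC, xp7 _hC, xp6 _hC, xp5 _hC, xp4 _hC, xp3 _hC,
          _hC]) <;> (try ring_nf))

end StubKerrVacuum

/-- **Registered sub-goal `stub_kerrVacuumRicciAlg`** of stub `stub_kerrVacuum` (line
`tapered-temporal-collar`): the sixteen coordinate identities `R_{kl} = 0` of the Kerr metric,
modulo the quartic.
[cite: KerrSchild1965, §3] -/
theorem stub_kerrVacuumRicciAlg : ∀ (a M x₁ x₂ r c : ℝ),
    r ≠ 0 → r ^ 2 + a ^ 2 * c ^ 2 ≠ 0 → r ^ 2 + a ^ 2 ≠ 0 → x₂ ^ 2 = (r ^ 2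
    + a ^ 2) * (1 - c ^ 2) - x₁ ^ 2 → ∀ (k l : Fin 4),
    2⁻¹ * (StubKerrVacuum.phiT a M x₁ x₂ r c k l
    + StubKerrVacuum.phiT a M x₁ x₂ r c l k - StubKerrVacuum.xiT a M x₁ x₂ r c k l) - ∑ m : Fin 4,
    StubKerrVacuum.gamT a M x₁ x₂ r c m k l * StubKerrVacuum.psiT a M x₁ x₂ r c m
    - StubKerrVacuum.t4T a M x₁ x₂ r c k l = 0 :=
  fun a M x₁ x₂ r c hr hS hP hC k l ↦ StubKerrVacuum.ricci_alg a M x₁ x₂ r c hr hS hP hC k l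

end Summit.FinalStateConjecture.FinalStateConjecture.Theorems.SwallowTheDatum.KerrShieldedSettles
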